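import Summits.QuantumFields.YangMills.Theorems.LangevinControlUVOSLegsFromFemtoAndGapDefs
import HarnessLib

/-!
# Census note (ym-idea-6 g16): the ABSTRACT Feynman–Hellmann split of LINE μ's `stub_slabResponse` is vacuous

Card `Cruxes/NT/Ideas/feynman-hellmann-slab-skewness.md` (ym-cruxidea-19353-2 g11) types the IR branch of the slab response as
`SlabTransport v h n μ τ ∧ MassShrinkage n μ c ⇒ RelSkewFloor v h (c − τ)` with the slab thickness `n : ℝ → ℝ` and the shrinkage
rate `μ : ℝ → ℕ → ℝ` FREE function parameters (intended `n = ⌊w/a⌋`, `μ = −∂_β m̂(β, L)`, but no lattice mass `m̂` is a tree object).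
As REGISTERED stubs (`∃ n μ, …`) the split carries no content: with `n := 1`, `μ := Q3/Q2`, `τ := 0` the transport law holds by `rfl`-algebra
wherever `Q2 ≠ 0` (which the clause-(i) floor guarantees), and `MassShrinkage 1 (Q3/Q2) c` IS the relative skewness floor `c ≤ Q3/Q2`.
Hence a non-vacuous FH sub-split of `stub_slabResponse` needs a DEFINED rate `μ`, not an `∃ μ` — §2 pins it IN VOCABULARY (global
log-responses at two heights; no new Literature definition), and LINE μ rev 6 files that pinned split as `stub_fhTransport` ∧ `stub_monotoneEffMass`.
Nothing about NT is proved here; this file only certifies the census claim and the recipe.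
-/

set_option autoImplicit false

noncomputable section

open scoped SchwartzMap
open Literature.MathematicalPhysics.QuantumFieldTheory Literature.MathematicalPhysics.QuantumLattice
open Summit.QuantumFields.YangMills.Cruxes.OSLegsFromFemtoAndGap.DlrCollarTransfer

namespace Summit.QuantumFields.YangMills.Cruxes.NT.FHSplitVacuity

variable (G : Type) [Group G] [TopologicalSpace G] [IsTopologicalGroup G] [CompactSpace G]
  [MeasurableSpace G] [BorelSpace G] (r : LatticeRep G) (a : ℝ → ℝ)

/-- Verbatim `SlabSkewness.RelSkewFloor` (card g11). [folklore] -/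
def RelSkewFloor (v h : 𝓢(EuclideanSpace ℝ (Fin 4), ℝ)) (κ β₅ Λ₅ : ℝ) : Prop :=
  ∀ β : ℝ, β₅ ≤ β → ∀ L : ℕ, Λ₅ ≤ a β * L →
    κ * Q2 G r β L (a β) (thetaTest 4 v) v ≤ Q3 G r β L (a β) (thetaTest 4 v) v h

/-- Verbatim `SlabSkewness.SlabTransport` (card g11): `|Q3 − n μ Q2| ≤ τ Q2`, with `n`, `μ` free parameters. [folklore] -/
def SlabTransport (v h : 𝓢(EuclideanSpace ℝ (Fin 4), ℝ)) (n : ℝ → ℝ) (μ : ℝ → ℕ → ℝ) (τ β₅ Λ₅ : ℝ) :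
    Prop :=
  ∀ β : ℝ, β₅ ≤ β → ∀ L : ℕ, Λ₅ ≤ a β * L →
    |Q3 G r β L (a β) (thetaTest 4 v) v h - n β * μ β L * Q2 G r β L (a β) (thetaTest 4 v) v| ≤
      τ * Q2 G r β L (a β) (thetaTest 4 v) v

/-- Verbatim `SlabSkewness.MassShrinkage` (card g11): `c ≤ n μ`. [folklore] -/
def MassShrinkage (n : ℝ → ℝ) (μ : ℝ → ℕ → ℝ) (c β₅ Λ₅ : ℝ) : Prop :=
  ∀ β : ℝ, β₅ ≤ β → ∀ L : ℕ, Λ₅ ≤ a β * L → c ≤ n β * μ β L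

variable {G r a}

/-- VACUITY 1: with `n := 1`, `μ := Q3/Q2`, the transport law holds with error `τ = 0` wherever `Q2 ≠ 0`. -/
theorem slabTransport_trivial (v h : 𝓢(EuclideanSpace ℝ (Fin 4), ℝ)) {β₅ Λ₅ : ℝ}
    (hQ2 : ∀ β : ℝ, β₅ ≤ β → ∀ L : ℕ, Λ₅ ≤ a β * L → Q2 G r β L (a β) (thetaTest 4 v) v ≠ 0) :
    SlabTransport G r a v h (fun _ => 1)
      (fun β L => Q3 G r β L (a β) (thetaTest 4 v) v h / Q2 G r β L (a β) (thetaTest 4 v) v) 0 β₅ Λ₅ := by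
  intro β hβ L hL
  have hq := hQ2 β hβ L hL
  rw [one_mul, div_mul_cancel₀ _ hq, sub_self, abs_zero, zero_mul]

/-- VACUITY 2: for that choice, `MassShrinkage` is literally the relative skewness floor `c · Q2 ≤ Q3` (given `Q2 > 0`,
which the clause-(i) floor `ε ≤ Q2`, `0 < ε`, supplies). -/
theorem massShrinkage_trivial_iff (v h : 𝓢(EuclideanSpace ℝ (Fin 4), ℝ)) {c β₅ Λ₅ : ℝ}
    (hQ2 : ∀ β : ℝ, β₅ ≤ β → ∀ L : ℕ, Λ₅ ≤ a β * L → 0 < Q2 G r β L (a β) (thetaTest 4 v) v) :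
    MassShrinkage a (fun _ => 1)
        (fun β L => Q3 G r β L (a β) (thetaTest 4 v) v h / Q2 G r β L (a β) (thetaTest 4 v) v) c β₅ Λ₅ ↔
      RelSkewFloor G r a v h c β₅ Λ₅ := by
  constructor
  · intro hM β hβ L hL
    have hq := hQ2 β hβ L hL
    have := hM β hβ L hL
    rw [one_mul, le_div_iff₀ hq] at this
    exact this
  · intro hR β hβ L hL
    have hq := hQ2 β hβ L hL
    rw [one_mul, le_div_iff₀ hq]
    exact hR β hβ L hL

/-- Hence the abstract split `∃ n μ τ c, τ < c ∧ SlabTransport ∧ MassShrinkage` is EQUIVALENT to `∃ κ > 0, RelSkewFloor κ` on floor-carrying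
data — no debt is moved by it. -/
theorem abstract_split_iff (v h : 𝓢(EuclideanSpace ℝ (Fin 4), ℝ)) {β₅ Λ₅ : ℝ}
    (hQ2 : ∀ β : ℝ, β₅ ≤ β → ∀ L : ℕ, Λ₅ ≤ a β * L → 0 < Q2 G r β L (a β) (thetaTest 4 v) v) :
    (∃ (n : ℝ → ℝ) (μ : ℝ → ℕ → ℝ) (τ c : ℝ), τ < c ∧ SlabTransport G r a v h n μ τ β₅ Λ₅ ∧ MassShrinkage a n μ c β₅ Λ₅) ↔
      ∃ κ : ℝ, 0 < κ ∧ RelSkewFloor G r a v h κ β₅ Λ₅ := by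
  constructor
  · rintro ⟨n, μ, τ, c, hτc, hT, hM⟩
    refine ⟨c - τ, sub_pos.mpr hτc, ?_⟩
    intro β hβ L hL
    have hq := hQ2 β hβ L hL
    have h1 := hT β hβ L hL
    have h2 := hM β hβ L hL
    have h3 : n β * μ β L * Q2 G r β L (a β) (thetaTest 4 v) v - τ * Q2 G r β L (a β) (thetaTest 4 v) v ≤
        Q3 G r β L (a β) (thetaTest 4 v) v h := by
      have := (abs_le.mp h1).1
      linarith
    have h4 : c * Q2 G r β L (a β) (thetaTest 4 v) v ≤ n β * μ β L * Q2 G r β L (a β) (thetaTest 4 v) v :=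
      mul_le_mul_of_nonneg_right h2 hq.le
    calc (c - τ) * Q2 G r β L (a β) (thetaTest 4 v) v
        = c * Q2 G r β L (a β) (thetaTest 4 v) v - τ * Q2 G r β L (a β) (thetaTest 4 v) v := by ring
      _ ≤ Q3 G r β L (a β) (thetaTest 4 v) v h := by linarith
  · rintro ⟨κ, hκ, hR⟩
    refine ⟨fun _ => 1, fun β L => Q3 G r β L (a β) (thetaTest 4 v) v h / Q2 G r β L (a β) (thetaTest 4 v) v, 0, κ, hκ,
      slabTransport_trivial v h (fun β hβ L hL => (hQ2 β hβ L hL).ne'), ?_⟩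
    exact (massShrinkage_trivial_iff v h hQ2).mpr hR

end Summit.QuantumFields.YangMills.Cruxes.NT.FHSplitVacuity

/-! ## §2 The in-vocabulary pin (non-vacuous re-typing; FILED as §FH of LINE μ rev 6, `Lines/slab_response_birth.lean` — both stubs XL, IR-class)

The rate can be PINNED without any new Literature definition: at fixed lattice geometry (unit frozen at `a β`) the GLOBAL
log-response of the mirror form of a bump `v` is `R v β L := ∂_b log Q2(θv, v)|_{b = β}` (a defined real: `deriv`; the landed
`Cruxes.NT.SkewResponseCoupling.hasDerivAt_Q2_coupling` identifies it with the global third cumulant).  For the SAME bump shape at two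
heights `s < s + Δ` (`v₁` low, `v₂` high) one-particle saturation makes the overlap factors cancel in the difference, so
`μ_eff β L := (R v₂ − R v₁) · a β / (2Δ) ≈ −∂_β m̂` (the shrinkage rate of the effective lattice mass), and the Feynman–Hellmann law for a
slab of physical width `w` between `θv₁` and `v₁` reads `Q3(θv₁, v₁, h_w) ≈ (w / a β) · μ_eff · Q2(θv₁, v₁) = (w/2Δ)(R v₂ − R v₁) · Q2(θv₁, v₁)`
— the unit `a β` cancels.  The two honest stubs are then `FHTransport` (identity with relative remainder `τ < 1`; content: isolated
one-particle branch + secular dominance of the Duhamel sum — needs the UPPER gap at weak coupling) and `MonotoneEffMass`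
(`(w/2Δ)(R v₂ − R v₁) ≥ c > 0`: the higher pair responds MORE to the coupling, i.e. the effective mass DEcreases in β at rate `≥ c·a/w` —
«asymptotic freedom from below», above Chatterjee's open Problem 5.1).  `relSkewFloor_of_pinned` is the (trivial) algebra; the point of
§2 is only that the split CAN be typed non-vacuously in NT's vocabulary. -/

namespace Summit.QuantumFields.YangMills.Cruxes.NT.FHSplitVacuity

variable (G : Type) [Group G] [TopologicalSpace G] [IsTopologicalGroup G] [CompactSpace G]
  [MeasurableSpace G] [BorelSpace G] (r : LatticeRep G) (a : ℝ → ℝ)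

/-- GLOBAL log-response of the mirror form of `v` at fixed lattice geometry (unit frozen at `a β`):
`R v β L = ∂_b Q2(θv, v)(b, L, a β)|_{b=β} / Q2(θv, v)(β, L, a β)`. [folklore] -/
def logResponse (v : 𝓢(EuclideanSpace ℝ (Fin 4), ℝ)) (β : ℝ) (L : ℕ) : ℝ :=
  deriv (fun b : ℝ => Q2 G r b L (a β) (thetaTest 4 v) v) β / Q2 G r β L (a β) (thetaTest 4 v) v

/-- Effective mass-shrinkage rate from two heights `Δ` apart (`v₁` low, `v₂` high; intended `v₂ = v₁(· − Δe₀)`):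
`μ_eff = (R v₂ − R v₁) · a β / (2Δ) ≈ −∂_β m̂_eff`. [folklore] -/
def effMassRate (v₁ v₂ : 𝓢(EuclideanSpace ℝ (Fin 4), ℝ)) (Δ : ℝ) (β : ℝ) (L : ℕ) : ℝ :=
  (logResponse G r a v₂ β L - logResponse G r a v₁ β L) * a β / (2 * Δ)

/-- PINNED Feynman–Hellmann transport law for a slab `h` of physical width `w` between `θv₁` and `v₁`:
`|Q3(θv₁, v₁, h) − (w / a β) · μ_eff · Q2(θv₁, v₁)| ≤ τ · (w / a β) · |μ_eff| · Q2(θv₁, v₁)`. [folklore] -/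
def FHTransport (v₁ v₂ h : 𝓢(EuclideanSpace ℝ (Fin 4), ℝ)) (w Δ τ β₅ Λ₅ : ℝ) : Prop :=
  ∀ β : ℝ, β₅ ≤ β → ∀ L : ℕ, Λ₅ ≤ a β * L →
    |Q3 G r β L (a β) (thetaTest 4 v₁) v₁ h - w / a β * effMassRate G r a v₁ v₂ Δ β L * Q2 G r β L (a β) (thetaTest 4 v₁) v₁| ≤
      τ * (w / a β * |effMassRate G r a v₁ v₂ Δ β L| * Q2 G r β L (a β) (thetaTest 4 v₁) v₁)

/-- PINNED mass shrinkage («AF from below» at fixed lattice geometry): `c ≤ (w / a β) · μ_eff`, i.e.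
`(w / 2Δ) · (R v₂ − R v₁) ≥ c` when `a β ≠ 0` — the higher pair's log-response exceeds the lower pair's by a fixed amount. [folklore] -/
def MonotoneEffMass (v₁ v₂ : 𝓢(EuclideanSpace ℝ (Fin 4), ℝ)) (w Δ c β₅ Λ₅ : ℝ) : Prop :=
  ∀ β : ℝ, β₅ ≤ β → ∀ L : ℕ, Λ₅ ≤ a β * L → c ≤ w / a β * effMassRate G r a v₁ v₂ Δ β L

variable {G r a}

/-- The pinned split pays the signed relative skewness floor with `κ = (1 − τ)·c` wherever the mirror form is non-negative
(clause-(i) floor / RP).  Trivial algebra — the content is in `FHTransport` and `MonotoneEffMass`. -/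
theorem relSkewFloor_of_pinned (v₁ v₂ h : 𝓢(EuclideanSpace ℝ (Fin 4), ℝ)) {w Δ τ c β₅ Λ₅ : ℝ}
    (hτ0 : 0 ≤ τ) (hτ : τ < 1) (hc : 0 < c)
    (hQ2 : ∀ β : ℝ, β₅ ≤ β → ∀ L : ℕ, Λ₅ ≤ a β * L → 0 ≤ Q2 G r β L (a β) (thetaTest 4 v₁) v₁)
    (hT : FHTransport G r a v₁ v₂ h w Δ τ β₅ Λ₅) (hM : MonotoneEffMass G r a v₁ v₂ w Δ c β₅ Λ₅) :
    RelSkewFloor G r a v₁ h ((1 - τ) * c) β₅ Λ₅ := by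
  intro β hβ L hL
  set q := Q2 G r β L (a β) (thetaTest 4 v₁) v₁ with hq_def
  set e := effMassRate G r a v₁ v₂ Δ β L with he_def
  set m := w / a β * e with hm_def
  have hq : 0 ≤ q := hQ2 β hβ L hL
  have hmc : c ≤ m := hM β hβ L hL
  have hm : 0 < m := lt_of_lt_of_le hc hmc
  have h1 := (abs_le.mp (hT β hβ L hL)).1
  -- `w / a β * |e| ≤ |m|` (equality unless the signs differ, which `m > 0` forbids anyway)
  have habs : w / a β * |e| ≤ |m| := by
    rw [hm_def, abs_mul]
    exact mul_le_mul_of_nonneg_right (le_abs_self _) (abs_nonneg _)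
  have hm_abs : |m| = m := abs_of_pos hm
  have h2 : τ * (w / a β * |e| * q) ≤ τ * (m * q) := by
    apply mul_le_mul_of_nonneg_left _ hτ0
    rw [← hm_abs]
    exact mul_le_mul_of_nonneg_right habs hq
  have h3 : m * q - τ * (m * q) ≤ Q3 G r β L (a β) (thetaTest 4 v₁) v₁ h := by linarith
  calc (1 - τ) * c * q ≤ (1 - τ) * m * q := by
        apply mul_le_mul_of_nonneg_right _ hq
        exact mul_le_mul_of_nonneg_left hmc (by linarith)
    _ = m * q - τ * (m * q) := by ring
    _ ≤ _ := h3

/-- … and `MonotoneEffMass` is unit-free: for `a β ≠ 0`, `Δ ≠ 0` it says `c ≤ (w / (2Δ)) · (R v₂ − R v₁)`. -/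
theorem monotoneEffMass_iff (v₁ v₂ : 𝓢(EuclideanSpace ℝ (Fin 4), ℝ)) {w Δ c β₅ Λ₅ : ℝ} (hΔ : Δ ≠ 0)
    (ha : ∀ β, a β ≠ 0) :
    MonotoneEffMass G r a v₁ v₂ w Δ c β₅ Λ₅ ↔
      ∀ β : ℝ, β₅ ≤ β → ∀ L : ℕ, Λ₅ ≤ a β * L →
        c ≤ w / (2 * Δ) * (logResponse G r a v₂ β L - logResponse G r a v₁ β L) := by
  have key : ∀ β L, w / a β * effMassRate G r a v₁ v₂ Δ β L =
      w / (2 * Δ) * (logResponse G r a v₂ β L - logResponse G r a v₁ β L) := by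
    intro β L
    simp only [effMassRate]
    field_simp [ha β, hΔ]
  constructor
  · intro hM β hβ L hL; rw [← key]; exact hM β hβ L hL
  · intro hM β hβ L hL; rw [key]; exact hM β hβ L hL

end Summit.QuantumFields.YangMills.Cruxes.NT.FHSplitVacuity


end
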